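import Summits.AtomisticToContinuum.HydrodynamicLimit.Theses.HeatBathForgetting
import HarnessLib

/-!
# Crux `CellRefresh` (stmt-AtomisticToContinuum-9451) — BIRTH SKELETON `Lines/birth.lean`

Route `HeatBathForgetting` (route-AtomisticToContinuum-HeatBathForgetting), sub-problem
`HydrodynamicLimit`; crux decl
`Summit.AtomisticToContinuum.HydrodynamicLimit.Theses.HeatBathForgetting.CellRefresh`
(law-level forgetting, within the window `τ_N = (N+1)^{-1/12}`, of every conservative cellwise
surgery `Ψ` applied at time `s` to the TRUE evolution of the local Gibbs law, tested on normalised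
one-particle cell observables `A`).

## The cut: forgetting along the evolution = fresh-data forgetting + restart-invariance of the response

Write `Δ_true(s, Ψ) := E_P[A(Φ_{s+τ} z)] − E_P[A(Φ_τ (Ψ (Φ_s z)))]` (the crux bounds `|Δ_true| ≤ δ τ_N`)
and, for the FRESH local Gibbs law `G_s := localGibbsLaw σ a_s u_s θ_s` carrying the time-`s` Euler
data through the local-density (LDA) activity `a_s = ρ_s · exp(F(ρ_sσ³) + ρ_sσ³ F'(ρ_sσ³))`,
`F = hsExcessFreeEnergy` (the inverse equation of state, as in `JaynesSqueeze.HardSphereLDA` and the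
`RestartPrinciple` lines), the fresh response `Δ_fresh(s, Ψ) := E_{G_s}[A(Φ_τ z)] − E_{G_s}[A(Φ_τ (Ψ z))]`.

* `stub_freshGibbsRefresh` (THE HEAT BATH PROPER; open-problem, the mechanism stub): `|Δ_fresh| ≤ δ τ_N`
  — a local Gibbs gas, conservatively scrambled inside the mesoscopic cells at time `0`, forgets the
  scrambling in law within the window, UNIFORMLY over the LDA profiles `(a_s, u_s, θ_s)`, `s ≤ t`, of the
  pinned Euler solution. All the randomness the card "the gas is its own heat bath" wants to borrow
  is EXPLICIT here (the exterior of every cell is Gibbs at the surgery time): this is the setting of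
  the stochastic-reservoir / Doeblin theorems (GoldsteinKipnisIaniro1985, KhaninYarmola2013) and of
  the route's layer-2 plan (InjectionRegularity → DrivenCellDoeblin). It is NOT the crux: no history,
  a different (explicit) initial law; it is the crux's `s = 0` instance transported to every LDA
  profile along the solution with ONE `σ₀`.
* `stub_responseRestart` (RESTART-INVARIANCE OF THE SURGERY RESPONSE; open-problem, carries the
  history — rated hardest): `|Δ_true(s, Ψ) − Δ_fresh(s, Ψ)| ≤ δ τ_N` — the true time-`s` law and the
  fresh LDA-Gibbs law respond identically, to `o(τ_N)`, to every admissible surgery as seen by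
  one-particle cell observables one window later. A difference-of-differences: it never compares a
  law with a deterministic prediction, so it is immune to the junk branches of the equation of state
  and to the degenerate (zero-mass) laws exactly as the crux is, and it does not assert `P_s ≈ G_s`.
* `CellRefresh_of` : the two signatures → `CellRefresh` (by name). Real proof: `σ₀ := min`, `N₀ := max`,
  both stubs at `δ/2`, the `let`-telescope of the crux introduced and the triangle inequality
  `|X| ≤ |X − Y| + |Y|` (`abs_le_of_response_of_fresh`). `CellRefresh_of_stubs` applies it to the stubs.

Disproof used: none relevant (no `Disproof.lean` / Negative lemma exists for this crux at birth;
`ledger crux ls` empty, negatives index has no CellRefresh-shaped entry). Free-flight caveat recorded by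
the grounder (forgetting fails for the FREE gas) applies verbatim to `stub_freshGibbsRefresh`: any proof
must use collisions (`σ > 0` throughout).

BC3 audit (this file): `lean check --json` rc 0, sorries = 2 = stubs (`stub_freshGibbsRefresh`,
`stub_responseRestart`), zero elsewhere; per-stub probes `stub → CellRefresh` and
`stub → _root_.HydrodynamicLimit` by `first | exact? | simpa [S] | (unfold S; simpa) | aesop` FAIL
(files `bc/CellRefresh_probe_fresh.lean`, `bc/CellRefresh_probe_restart.lean`; outputs in NOTES.md).
-/

noncomputable section

namespace Summit.AtomisticToContinuum.HydrodynamicLimit.Cruxes.CellRefresh.Birth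

open scoped BigOperators Topology Manifold Classical MeasureTheory ProbabilityTheory Matrix InnerProductSpace ComplexConjugate ContinuousMap
open Filter Set Function TopologicalSpace MeasureTheory
open Literature.MathematicalPhysics.KineticTheory Literature.Analysis.FluidPDE Literature.Analysis.FunctionSpaces
open Summit.AtomisticToContinuum.HydrodynamicLimit.Theses.HeatBathForgetting (CellRefresh)

/-- Elementary seam of the skeleton: `|X − Y| ≤ (δ/2)τ` and `|Y| ≤ (δ/2)τ` give `|X| ≤ δτ`. -/
theorem abs_le_of_response_of_fresh {X Y δ τ : ℝ} (h₁ : |X - Y| ≤ δ / 2 * τ) (h₂ : |Y| ≤ δ / 2 * τ) :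
    |X| ≤ δ * τ := by
  have h₃ := abs_sub_abs_le_abs_sub X Y
  linarith

/-- STUB `stub_freshGibbsRefresh` — **fresh-data cell refresh (the heat bath proper).** Same prefix as the
crux (profiles, `σ < σ₀`, pinned classical hs-Euler solution, flows, `t < T`, one-particle cell test
function `g`, `δ`, `N ≥ N₀`, `s ≤ t`, centre `x`, admissible surgery `Ψ`: Liouville-preserving,
hard-core-preserving, cell-preserving particlewise, conserving every cell's momentum and kinetic energy),
but the surgery acts at time `0` on the FRESH local Gibbs law `G_s = localGibbsLaw σ a_s (u s) (θ s)` with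
the LDA activity `a_s = ρ_s exp(F(ρ_sσ³) + ρ_sσ³F'(ρ_sσ³))`, `F = hsExcessFreeEnergy`:
`|E_{G_s}[A(Φ_τ z)] − E_{G_s}[A(Φ_τ (Ψ z))]| ≤ δ τ_N`, `τ_N = (N+1)^{-1/12}`, cells of mesh
`1/⌊(N+1)^{1/4}⌋₊`. Why plausibly true: at the surgery time the exterior of every cell is explicitly
Gibbs, cells are flushed diffusively in time `(N+1)^{-1/6} log N ≪ τ_N`, sub-cell modes damp at rate
`N^{1/6}`; the cellwise-constant-parameter Gibbs law is exactly `Ψ`-invariant and the smooth LDA law is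
`N^{-1/8} = o(τ_N)`-close to it cell by cell. Why it might fail: demon surgeries reading the exterior,
slow velocity tails (Yarmola2014), free-flight failure (collisions essential). Size: open-problem (XL).
[GoldsteinKipnisIaniro1985; KhaninYarmola2013; Yarmola2014; DobrushinShlosman1985; OllaVaradhanYau1993 §3] -/
theorem stub_freshGibbsRefresh :
    ∀ (a₀ θ₀ : T3 → ℝ) (u₀ : T3 → V3), Continuous a₀ → Continuous θ₀ → Continuous u₀ →
    (∀ x, 0 < a₀ x) → (∀ x, 0 < θ₀ x) →
    ∃ σ₀ : ℝ, 0 < σ₀ ∧ ∀ σ : ℝ, 0 < σ → σ < σ₀ →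
    ∀ (T : ℝ) (ρ θ : ℝ → T3 → ℝ) (u : ℝ → T3 → V3), IsHardSphereEulerSolution σ T ρ u θ →
    ∀ Φ : (N : ℕ) → HardSphereFlow (Torus.geometry (Fin 3)) (hsDiameter σ N) (N + 1),
    TendstoHydroFieldsAt (fun N => localGibbsLaw σ a₀ u₀ θ₀ N (Φ N)) Φ ρ u θ 0 →
    ∀ t ∈ Set.Ico 0 T, ∀ g : V3 × V3 → ℝ, Continuous g → (∀ p, |g p| ≤ 1) →
    (∀ p, 1 ≤ ‖p.1‖ → g p = 0) → ∀ δ : ℝ, 0 < δ → ∃ N₀ : ℕ, ∀ N : ℕ, N₀ ≤ N →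
    ∀ s ∈ Set.Icc 0 t, ∀ (x : T3) (Ψ : Config (N + 1) (Fin 3) T3 → Config (N + 1) (Fin 3) T3),
    (let M : ℕ := ⌊((N + 1 : ℕ) : ℝ) ^ (1 / 4 : ℝ)⌋₊
     let hN : ℝ := (M : ℝ)⁻¹
     let τN : ℝ := ((N + 1 : ℕ) : ℝ) ^ (-(1 / 12 : ℝ))
     let G := localGibbsLaw σ (fun y => ρ s y * Real.exp (hsExcessFreeEnergy (ρ s y * σ ^ 3) +
       ρ s y * σ ^ 3 * deriv hsExcessFreeEnergy (ρ s y * σ ^ 3))) (u s) (θ s) N (Φ N)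
     let cell := fun (y : T3) (j : Fin 3) => ⌊(M : ℝ) * Torus.repr y j⌋
     let A := fun (w : Config (N + 1) (Fin 3) T3) =>
       (hN ^ 3)⁻¹ * ∫ y, g (hN⁻¹ • Torus.reprSym (y.1 - x), y.2) ∂(empiricalMeasure w)
     MeasureTheory.MeasurePreserving Ψ (liouville (Torus.geometry (Fin 3)) (N + 1) (hsDiameter σ N))
        (liouville (Torus.geometry (Fin 3)) (N + 1) (hsDiameter σ N)) →
     (∀ z ∈ hardSphereDomain (Torus.geometry (Fin 3)) (N + 1) (hsDiameter σ N),
        Ψ z ∈ hardSphereDomain (Torus.geometry (Fin 3)) (N + 1) (hsDiameter σ N)) →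
     (∀ z i, cell (Ψ z i).1 = cell (z i).1) →
     (∀ z (c : Fin 3 → ℤ),
        (∑ i ∈ Finset.univ.filter (fun i => cell (z i).1 = c), (Ψ z i).2) =
            ∑ i ∈ Finset.univ.filter (fun i => cell (z i).1 = c), (z i).2 ∧
          (∑ i ∈ Finset.univ.filter (fun i => cell (z i).1 = c), ‖(Ψ z i).2‖ ^ 2) =
            ∑ i ∈ Finset.univ.filter (fun i => cell (z i).1 = c), ‖(z i).2‖ ^ 2) →
     |(∫ z, A ((Φ N).flow τN z) ∂G) - ∫ z, A ((Φ N).flow τN (Ψ z)) ∂G| ≤ δ * τN) := by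
  sorry

/-- STUB `stub_responseRestart` — **restart-invariance of the surgery response (carries the history;
rated the hardest stub).** Same prefix and admissibility hypotheses as the crux; conclusion: the
response of the TRUE time-`s` law `P ∘ Φ_s⁻¹` (`P` the initial local Gibbs law) and the response of the
FRESH LDA local Gibbs law `G_s` (as in `stub_freshGibbsRefresh`) to the same admissible surgery, read on
the same one-particle cell observable one window `τ_N` later, agree to `o(τ_N)`:
`|(E_P[A(Φ_{s+τ} z)] − E_P[A(Φ_τ(Ψ(Φ_s z)))]) − (E_{G_s}[A(Φ_τ z)] − E_{G_s}[A(Φ_τ(Ψ z))])| ≤ δ τ_N`.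
A difference of differences: it does not assert `P_s ≈ G_s` (only that history does not change the
RESPONSE), never compares a law with a deterministic prediction (immune to equation-of-state junk and
to zero-mass laws exactly as the crux is), and with `stub_freshGibbsRefresh` it yields the crux by the
triangle inequality. Why plausibly true: the true law differs from the LDA local Gibbs law at time `s`
by Chapman–Enskog corrections of relative size `Kn ≍ (N+1)^{-1/3} ≪ τ_N` in every one- and two-body
statistic a surgery response can feed on. Why it might fail: a Liouville-preserving demon surgery can
read the GLOBAL microstate, where `P_s` and `G_s` are far apart in total variation, and act differently
under the two laws — then the stub needs both responses to be `o(τ_N)` separately (i.e. forgetting for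
each law). Size: open-problem (XL; hydrodynamic-limit-hard in the restart sense of Yau1991).
[Yau1991 §1; OllaVaradhanYau1993 §3; KipnisLandim1999 Ch. 6; Spohn1991 §3.3] -/
theorem stub_responseRestart :
    ∀ (a₀ θ₀ : T3 → ℝ) (u₀ : T3 → V3), Continuous a₀ → Continuous θ₀ → Continuous u₀ →
    (∀ x, 0 < a₀ x) → (∀ x, 0 < θ₀ x) →
    ∃ σ₀ : ℝ, 0 < σ₀ ∧ ∀ σ : ℝ, 0 < σ → σ < σ₀ →
    ∀ (T : ℝ) (ρ θ : ℝ → T3 → ℝ) (u : ℝ → T3 → V3), IsHardSphereEulerSolution σ T ρ u θ →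
    ∀ Φ : (N : ℕ) → HardSphereFlow (Torus.geometry (Fin 3)) (hsDiameter σ N) (N + 1),
    TendstoHydroFieldsAt (fun N => localGibbsLaw σ a₀ u₀ θ₀ N (Φ N)) Φ ρ u θ 0 →
    ∀ t ∈ Set.Ico 0 T, ∀ g : V3 × V3 → ℝ, Continuous g → (∀ p, |g p| ≤ 1) →
    (∀ p, 1 ≤ ‖p.1‖ → g p = 0) → ∀ δ : ℝ, 0 < δ → ∃ N₀ : ℕ, ∀ N : ℕ, N₀ ≤ N →
    ∀ s ∈ Set.Icc 0 t, ∀ (x : T3) (Ψ : Config (N + 1) (Fin 3) T3 → Config (N + 1) (Fin 3) T3),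
    (let M : ℕ := ⌊((N + 1 : ℕ) : ℝ) ^ (1 / 4 : ℝ)⌋₊
     let hN : ℝ := (M : ℝ)⁻¹
     let τN : ℝ := ((N + 1 : ℕ) : ℝ) ^ (-(1 / 12 : ℝ))
     let P := localGibbsLaw σ a₀ u₀ θ₀ N (Φ N)
     let G := localGibbsLaw σ (fun y => ρ s y * Real.exp (hsExcessFreeEnergy (ρ s y * σ ^ 3) +
       ρ s y * σ ^ 3 * deriv hsExcessFreeEnergy (ρ s y * σ ^ 3))) (u s) (θ s) N (Φ N)
     let cell := fun (y : T3) (j : Fin 3) => ⌊(M : ℝ) * Torus.repr y j⌋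
     let A := fun (w : Config (N + 1) (Fin 3) T3) =>
       (hN ^ 3)⁻¹ * ∫ y, g (hN⁻¹ • Torus.reprSym (y.1 - x), y.2) ∂(empiricalMeasure w)
     MeasureTheory.MeasurePreserving Ψ (liouville (Torus.geometry (Fin 3)) (N + 1) (hsDiameter σ N))
        (liouville (Torus.geometry (Fin 3)) (N + 1) (hsDiameter σ N)) →
     (∀ z ∈ hardSphereDomain (Torus.geometry (Fin 3)) (N + 1) (hsDiameter σ N),
        Ψ z ∈ hardSphereDomain (Torus.geometry (Fin 3)) (N + 1) (hsDiameter σ N)) →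
     (∀ z i, cell (Ψ z i).1 = cell (z i).1) →
     (∀ z (c : Fin 3 → ℤ),
        (∑ i ∈ Finset.univ.filter (fun i => cell (z i).1 = c), (Ψ z i).2) =
            ∑ i ∈ Finset.univ.filter (fun i => cell (z i).1 = c), (z i).2 ∧
          (∑ i ∈ Finset.univ.filter (fun i => cell (z i).1 = c), ‖(Ψ z i).2‖ ^ 2) =
            ∑ i ∈ Finset.univ.filter (fun i => cell (z i).1 = c), ‖(z i).2‖ ^ 2) →
     |((∫ z, A ((Φ N).flow (s + τN) z) ∂P) - ∫ z, A ((Φ N).flow τN (Ψ ((Φ N).flow s z))) ∂P) -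
        ((∫ z, A ((Φ N).flow τN z) ∂G) - ∫ z, A ((Φ N).flow τN (Ψ z)) ∂G)| ≤ δ * τN) := by
  sorry

/-- **COMPOSITION (kernel-checked, no `sorry`): the two stub signatures imply the crux `CellRefresh`
BY NAME.** `σ₀ := min σ₁ σ₂`, both stubs at tolerance `δ/2`, `N₀ := max N₁ N₂`; for `N ≥ N₀`, `s ≤ t`,
`x`, admissible `Ψ` the `let`-telescope of the crux is introduced and the two estimates are combined by
`abs_le_of_response_of_fresh` (`|X| ≤ |X − Y| + |Y|`). -/
theorem CellRefresh_of :
    (∀ (a₀ θ₀ : T3 → ℝ) (u₀ : T3 → V3), Continuous a₀ → Continuous θ₀ → Continuous u₀ →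
    (∀ x, 0 < a₀ x) → (∀ x, 0 < θ₀ x) →
    ∃ σ₀ : ℝ, 0 < σ₀ ∧ ∀ σ : ℝ, 0 < σ → σ < σ₀ →
    ∀ (T : ℝ) (ρ θ : ℝ → T3 → ℝ) (u : ℝ → T3 → V3), IsHardSphereEulerSolution σ T ρ u θ →
    ∀ Φ : (N : ℕ) → HardSphereFlow (Torus.geometry (Fin 3)) (hsDiameter σ N) (N + 1),
    TendstoHydroFieldsAt (fun N => localGibbsLaw σ a₀ u₀ θ₀ N (Φ N)) Φ ρ u θ 0 →
    ∀ t ∈ Set.Ico 0 T, ∀ g : V3 × V3 → ℝ, Continuous g → (∀ p, |g p| ≤ 1) →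
    (∀ p, 1 ≤ ‖p.1‖ → g p = 0) → ∀ δ : ℝ, 0 < δ → ∃ N₀ : ℕ, ∀ N : ℕ, N₀ ≤ N →
    ∀ s ∈ Set.Icc 0 t, ∀ (x : T3) (Ψ : Config (N + 1) (Fin 3) T3 → Config (N + 1) (Fin 3) T3),
    (let M : ℕ := ⌊((N + 1 : ℕ) : ℝ) ^ (1 / 4 : ℝ)⌋₊
     let hN : ℝ := (M : ℝ)⁻¹
     let τN : ℝ := ((N + 1 : ℕ) : ℝ) ^ (-(1 / 12 : ℝ))
     let G := localGibbsLaw σ (fun y => ρ s y * Real.exp (hsExcessFreeEnergy (ρ s y * σ ^ 3) +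
       ρ s y * σ ^ 3 * deriv hsExcessFreeEnergy (ρ s y * σ ^ 3))) (u s) (θ s) N (Φ N)
     let cell := fun (y : T3) (j : Fin 3) => ⌊(M : ℝ) * Torus.repr y j⌋
     let A := fun (w : Config (N + 1) (Fin 3) T3) =>
       (hN ^ 3)⁻¹ * ∫ y, g (hN⁻¹ • Torus.reprSym (y.1 - x), y.2) ∂(empiricalMeasure w)
     MeasureTheory.MeasurePreserving Ψ (liouville (Torus.geometry (Fin 3)) (N + 1) (hsDiameter σ N))
        (liouville (Torus.geometry (Fin 3)) (N + 1) (hsDiameter σ N)) →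
     (∀ z ∈ hardSphereDomain (Torus.geometry (Fin 3)) (N + 1) (hsDiameter σ N),
        Ψ z ∈ hardSphereDomain (Torus.geometry (Fin 3)) (N + 1) (hsDiameter σ N)) →
     (∀ z i, cell (Ψ z i).1 = cell (z i).1) →
     (∀ z (c : Fin 3 → ℤ),
        (∑ i ∈ Finset.univ.filter (fun i => cell (z i).1 = c), (Ψ z i).2) =
            ∑ i ∈ Finset.univ.filter (fun i => cell (z i).1 = c), (z i).2 ∧
          (∑ i ∈ Finset.univ.filter (fun i => cell (z i).1 = c), ‖(Ψ z i).2‖ ^ 2) =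
            ∑ i ∈ Finset.univ.filter (fun i => cell (z i).1 = c), ‖(z i).2‖ ^ 2) →
     |(∫ z, A ((Φ N).flow τN z) ∂G) - ∫ z, A ((Φ N).flow τN (Ψ z)) ∂G| ≤ δ * τN)) →
    (∀ (a₀ θ₀ : T3 → ℝ) (u₀ : T3 → V3), Continuous a₀ → Continuous θ₀ → Continuous u₀ →
    (∀ x, 0 < a₀ x) → (∀ x, 0 < θ₀ x) →
    ∃ σ₀ : ℝ, 0 < σ₀ ∧ ∀ σ : ℝ, 0 < σ → σ < σ₀ →
    ∀ (T : ℝ) (ρ θ : ℝ → T3 → ℝ) (u : ℝ → T3 → V3), IsHardSphereEulerSolution σ T ρ u θ →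
    ∀ Φ : (N : ℕ) → HardSphereFlow (Torus.geometry (Fin 3)) (hsDiameter σ N) (N + 1),
    TendstoHydroFieldsAt (fun N => localGibbsLaw σ a₀ u₀ θ₀ N (Φ N)) Φ ρ u θ 0 →
    ∀ t ∈ Set.Ico 0 T, ∀ g : V3 × V3 → ℝ, Continuous g → (∀ p, |g p| ≤ 1) →
    (∀ p, 1 ≤ ‖p.1‖ → g p = 0) → ∀ δ : ℝ, 0 < δ → ∃ N₀ : ℕ, ∀ N : ℕ, N₀ ≤ N →
    ∀ s ∈ Set.Icc 0 t, ∀ (x : T3) (Ψ : Config (N + 1) (Fin 3) T3 → Config (N + 1) (Fin 3) T3),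
    (let M : ℕ := ⌊((N + 1 : ℕ) : ℝ) ^ (1 / 4 : ℝ)⌋₊
     let hN : ℝ := (M : ℝ)⁻¹
     let τN : ℝ := ((N + 1 : ℕ) : ℝ) ^ (-(1 / 12 : ℝ))
     let P := localGibbsLaw σ a₀ u₀ θ₀ N (Φ N)
     let G := localGibbsLaw σ (fun y => ρ s y * Real.exp (hsExcessFreeEnergy (ρ s y * σ ^ 3) +
       ρ s y * σ ^ 3 * deriv hsExcessFreeEnergy (ρ s y * σ ^ 3))) (u s) (θ s) N (Φ N)
     let cell := fun (y : T3) (j : Fin 3) => ⌊(M : ℝ) * Torus.repr y j⌋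
     let A := fun (w : Config (N + 1) (Fin 3) T3) =>
       (hN ^ 3)⁻¹ * ∫ y, g (hN⁻¹ • Torus.reprSym (y.1 - x), y.2) ∂(empiricalMeasure w)
     MeasureTheory.MeasurePreserving Ψ (liouville (Torus.geometry (Fin 3)) (N + 1) (hsDiameter σ N))
        (liouville (Torus.geometry (Fin 3)) (N + 1) (hsDiameter σ N)) →
     (∀ z ∈ hardSphereDomain (Torus.geometry (Fin 3)) (N + 1) (hsDiameter σ N),
        Ψ z ∈ hardSphereDomain (Torus.geometry (Fin 3)) (N + 1) (hsDiameter σ N)) →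
     (∀ z i, cell (Ψ z i).1 = cell (z i).1) →
     (∀ z (c : Fin 3 → ℤ),
        (∑ i ∈ Finset.univ.filter (fun i => cell (z i).1 = c), (Ψ z i).2) =
            ∑ i ∈ Finset.univ.filter (fun i => cell (z i).1 = c), (z i).2 ∧
          (∑ i ∈ Finset.univ.filter (fun i => cell (z i).1 = c), ‖(Ψ z i).2‖ ^ 2) =
            ∑ i ∈ Finset.univ.filter (fun i => cell (z i).1 = c), ‖(z i).2‖ ^ 2) →
     |((∫ z, A ((Φ N).flow (s + τN) z) ∂P) - ∫ z, A ((Φ N).flow τN (Ψ ((Φ N).flow s z))) ∂P) -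
        ((∫ z, A ((Φ N).flow τN z) ∂G) - ∫ z, A ((Φ N).flow τN (Ψ z)) ∂G)| ≤ δ * τN)) →
    CellRefresh := by
  intro hF hR a₀ θ₀ u₀ ha hθ hu hap hθp
  obtain ⟨σ₁, hσ₁, H₁⟩ := hR a₀ θ₀ u₀ ha hθ hu hap hθp
  obtain ⟨σ₂, hσ₂, H₂⟩ := hF a₀ θ₀ u₀ ha hθ hu hap hθp
  refine ⟨min σ₁ σ₂, lt_min hσ₁ hσ₂, ?_⟩
  intro σ hσ hσlt T ρ θ u hsol Φ hpin t ht g hg hg1 hg0 δ hδ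
  obtain ⟨N₁, hN₁⟩ := H₁ σ hσ (lt_of_lt_of_le hσlt (min_le_left _ _)) T ρ θ u hsol Φ hpin t ht g hg
    hg1 hg0 (δ / 2) (half_pos hδ)
  obtain ⟨N₂, hN₂⟩ := H₂ σ hσ (lt_of_lt_of_le hσlt (min_le_right _ _)) T ρ θ u hsol Φ hpin t ht g hg
    hg1 hg0 (δ / 2) (half_pos hδ)
  refine ⟨max N₁ N₂, ?_⟩
  intro N hN s hs x Ψ
  have e₁ := hN₁ N (le_of_max_le_left hN) s hs x Ψ
  have e₂ := hN₂ N (le_of_max_le_right hN) s hs x Ψ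
  intro M hN' τN P cell A hΨ₁ hΨ₂ hΨ₃ hΨ₄
  exact abs_le_of_response_of_fresh (e₁ hΨ₁ hΨ₂ hΨ₃ hΨ₄) (e₂ hΨ₁ hΨ₂ hΨ₃ hΨ₄)

/-- The stubs literally compose to the crux (this also certifies that the registered stub signatures
are the hypotheses of `CellRefresh_of`). No `sorry` in this declaration; it depends on the two stubs. -/
theorem CellRefresh_of_stubs : CellRefresh :=
  CellRefresh_of stub_freshGibbsRefresh stub_responseRestart

end Summit.AtomisticToContinuum.HydrodynamicLimit.Cruxes.CellRefresh.Birth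

end
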